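import Summits.AnomalousDissipation.AnomalousDissipation.Theorems.SoloBlindZerothLawPinning
import Literature.Analysis.FluidPDE.DuchonRobertLionsEnergyEquality
import Literature.Analysis.FluidPDE.LerayHopfUniformEnergyMomentum

/-!
# Solo (blind) — the un-pinning door to `ZerothLaw` at Leray–Hopf level

`SoloBlindMomentumFluxMeans.zerothLaw_of_unpinned_classical_family` reduces `ZerothLaw` on the
Kolmogorov force `f = cos(2πx₃)e₁` to an UN-PINNING statement about the single quadratic moment
`A(t) = ∫ u₃ ⟪sin(2πx₃)e₁, u⟫` — but along families of GLOBAL CLASSICAL solutions, i.e. it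
silently conflates the zeroth law with global regularity of the forced Navier–Stokes system at
every `ν_j > 0`. This file removes that conflation. The identity
`meanPower f u = (½ − 2π·liminf_T ⟨A⟩_T)/(4π²ν)` holds for EVERY global Leray–Hopf solution
(`meanPower_kolForce_eq_inphase'`), so un-pinning by the margin `2πν ε` is EQUIVALENT to the
power floor `ε ≤ ⟨f·u⟩`; the only gap to the dissipation floor `ε ≤ ⟨ν‖∇u‖²⟩` demanded by
`ZerothLaw` is the Leray–Hopf power balance being an inequality `⟨ν‖∇u‖²⟩ ≤ ⟨f·u⟩`
(`DoeringFoias2002_dissipation_le_power_holds`). Hence: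

* `lh_meanPower_le_meanDissipation_of_energyEq` (any dimension, any steady mean-zero `L²`
  force): if a global Leray–Hopf solution satisfies the energy EQUALITY from `0` on every
  `[0, T]`, then `⟨f·u⟩ ≤ ⟨ν‖∇u‖²⟩` — the boundary term `(‖u(T)‖² − ‖u₀‖²)/(2T)` is `O(1/T)` by
  the tree's uniform trajectory bound
  `Torus.IsGlobalLerayHopf.exists_forall_integral_norm_sq_le_of_hasZeroMean` (FMRT 2001 (3.2));
  with the Leray–Hopf inequality, `⟨f·u⟩ = ⟨ν‖∇u‖²⟩` on `𝕋³` (`lh_meanPower_eq_meanDissipation_of_energyEq`);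
* `lh_energyEq_of_memL4` : Lions' class suffices — a global Leray–Hopf solution on `𝕋³` with
  `L²` datum and `u ∈ L⁴(0,T; L⁴)` for every `T` satisfies the energy equality (the tree's
  `lions_energy_equality_Ioc`, Lions 1960 / Shinbrot 1974);
* `floor_iff_unpinned_of_meanEnergyEq` : for a global Leray–Hopf solution of `NS_ν(kolForce)`
  with `⟨f·u⟩ ≤ ⟨ν‖∇u‖²⟩`, `ε ≤ meanDissipation ν u ↔ liminf_T ⟨A⟩_T ≤ 1/(4π) − 2πνε`;
* `zerothLaw_of_unpinned_LH_family` : **the door** — `ZerothLaw` follows from the existence of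
  viscosities `ν_j → 0` and global Leray–Hopf solutions `u_j` of `NS_{ν_j}(kolForce)` with mean
  energies `≤ E`, mean energy equality `⟨f·u_j⟩ ≤ ⟨ν_j‖∇u_j‖²⟩`, and
  `liminf_T ⟨A_j⟩_T ≤ 1/(4π) − 2πν_j ε` for one `ε > 0`; `zerothLaw_of_unpinned_L4_family` : the
  same with the mean energy equality replaced by `u_j ∈ L⁴_loc(ℝ₊; L⁴(𝕋³))` and `L²` data.

So on its natural witness class the zeroth law is the conjunction of two fixed-viscosity
properties of Leray–Hopf solutions of ONE forced system — energy equality in the mean (implied by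
Lions–Shinbrot integrability, far short of regularity) and un-pinning of one large-scale
quadratic moment — with no gradient, dissipation or fine-scale quantity left in the hypotheses.
The energy-equality hypothesis cannot be dropped by these means: a Leray–Hopf solution with
`⟨f·u⟩ > ⟨ν‖∇u‖²⟩` (anomalous dissipation of the weak solution itself at `ν > 0`, not excluded by
any theorem in print) would be un-pinned without a viscous floor.
[folklore; cite: DoeringFoias2002, §2; cite: Shinbrot1974, Thm.; cite: FMRT2001, Ch. IV (3.2)]
-/

open MeasureTheory Filter Topology Set UnitAddTorus
open scoped ENNReal NNReal InnerProductSpace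

noncomputable section

namespace Summit.AnomalousDissipation.AnomalousDissipation.Theorems

open Literature.Analysis.FunctionSpaces Literature.Analysis.FunctionSpaces.Torus
open Literature.Analysis.FluidPDE

/-! ### Mean energy equality from the trajectory energy equality -/

section General

variable {d : Type*} [Fintype d] [DecidableEq d] {ν : ℝ}
  {F u₀ : UnitAddTorus d → EuclideanSpace ℝ d} {u : ℝ → UnitAddTorus d → EuclideanSpace ℝ d}

/-- **Mean energy equality, upper half.** For a global Leray–Hopf solution on `T^d` driven by a
steady mean-zero force `F ∈ L²`, `ν > 0`, satisfying the energy EQUALITY from `0`,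
`½‖u(T)‖² + ν∫₀ᵀ‖∇u‖₂² = ½‖u₀‖² + ∫₀ᵀ∫⟪F,u⟫` for every `T > 0`, the mean injected power does not
exceed the mean dissipation: `⟨F·u⟩ ≤ ⟨ν‖∇u‖²⟩` (`limsup` Cesàro means). The trajectory is
bounded in `L²` uniformly in time (FMRT 2001, (3.2):
`Torus.IsGlobalLerayHopf.exists_forall_integral_norm_sq_le_of_hasZeroMean`), so
`⟨∫⟪F,u⟫⟩_T ≤ R/(2T) + ⟨ν‖∇u‖²⟩_T`, and `limsup` is monotone and subadditive along the
(co)bounded running means (`Torus.IsLerayHopfOn.intervalIntegral_power_bounds`).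
[folklore; cite: FMRT2001, Ch. IV §3.1 (3.2); cite: DoeringFoias2002, §2] -/
theorem lh_meanPower_le_meanDissipation_of_energyEq
    (hu : Torus.IsGlobalLerayHopf ν (fun _ => F) u₀ u) (hν : 0 < ν) (hF : MemLp F 2 volume)
    (hF0 : HasZeroMean F)
    (hEq : ∀ T, 0 < T →
      kineticEnergy (u T) + ν * (∫⁻ τ in Ioo 0 T, eGradNormSq (u τ)).toReal =
        kineticEnergy u₀ + ∫ τ in (0 : ℝ)..T, ∫ x, ⟪F x, u τ x⟫_ℝ) :
    meanPower F u ≤ meanDissipation ν u := by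
  obtain ⟨R, hR⟩ := hu.exists_forall_integral_norm_sq_le_of_hasZeroMean hν hF hF0
  set D : ℝ → ℝ := fun t => ν * (eGradNormSq (u t)).toReal with hD
  set P : ℝ → ℝ := fun t => ∫ x, ⟪F x, u t x⟫_ℝ with hP
  have hE0 : 0 ≤ kineticEnergy u₀ := kineticEnergy_nonneg _
  -- the running-mean inequalities, for every `T > 0`
  have key : ∀ T, 0 < T →
      timeMean P T ≤ R / 2 * T⁻¹ + timeMean D T ∧ 0 ≤ timeMean D T ∧
        timeMean D T ≤ 2 * kineticEnergy u₀ * T⁻¹ +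
          2 * ((4 * Real.pi ^ 2 * ν)⁻¹ / 2 * ∫ x, ‖F x‖ ^ 2) ∧
        -(kineticEnergy u₀ * T⁻¹) ≤ timeMean P T := by
    intro T hT
    have hLH := hu T hT
    obtain ⟨-, hPb⟩ := hLH.intervalIntegral_power_bounds hT hν hF hF0
    have hDP := hLH.intervalIntegral_dissipation_le hT
    have hDeq := (hLH.intervalIntegral_dissipation_eq hT).2
    have hDnn : 0 ≤ ∫ t in (0 : ℝ)..T, D t := by
      rw [hD, hDeq]
      exact mul_nonneg hν.le ENNReal.toReal_nonneg
    have hET := hEq T hT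
    rw [← hDeq] at hET
    have hKT : kineticEnergy (u T) ≤ R / 2 := by
      have h := hR T hT.le
      simp only [kineticEnergy]
      linarith
    have hPabs := abs_le.1 hPb
    have hTi : 0 < T⁻¹ := inv_pos.2 hT
    have hTT : T⁻¹ * T = 1 := inv_mul_cancel₀ hT.ne'
    have hPle : ∫ t in (0 : ℝ)..T, P t ≤ R / 2 + ∫ t in (0 : ℝ)..T, D t := by
      simp only [hP, hD]
      linarith
    simp only [timeMean]
    refine ⟨?_, mul_nonneg hTi.le hDnn, ?_, ?_⟩
    · calc T⁻¹ * ∫ t in (0 : ℝ)..T, P t ≤ T⁻¹ * (R / 2 + ∫ t in (0 : ℝ)..T, D t) :=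
            mul_le_mul_of_nonneg_left hPle hTi.le
        _ = R / 2 * T⁻¹ + T⁻¹ * ∫ t in (0 : ℝ)..T, D t := by ring
    · have h1 : ∫ t in (0 : ℝ)..T, D t ≤ kineticEnergy u₀ + (kineticEnergy u₀ +
          2 * ((4 * Real.pi ^ 2 * ν)⁻¹ / 2 * ∫ x, ‖F x‖ ^ 2) * T) := by
        simp only [hD]
        linarith [hPabs.2]
      calc T⁻¹ * ∫ t in (0 : ℝ)..T, D t ≤ T⁻¹ * (kineticEnergy u₀ + (kineticEnergy u₀ +
            2 * ((4 * Real.pi ^ 2 * ν)⁻¹ / 2 * ∫ x, ‖F x‖ ^ 2) * T)) :=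
            mul_le_mul_of_nonneg_left h1 hTi.le
        _ = 2 * kineticEnergy u₀ * T⁻¹ +
            2 * ((4 * Real.pi ^ 2 * ν)⁻¹ / 2 * ∫ x, ‖F x‖ ^ 2) * (T⁻¹ * T) := by ring
        _ = 2 * kineticEnergy u₀ * T⁻¹ +
            2 * ((4 * Real.pi ^ 2 * ν)⁻¹ / 2 * ∫ x, ‖F x‖ ^ 2) := by rw [hTT, mul_one]
    · have h2 : -kineticEnergy u₀ ≤ ∫ t in (0 : ℝ)..T, P t := by
        simp only [hP]
        have hDnn' : 0 ≤ ∫ t in (0 : ℝ)..T, ν * (eGradNormSq (u t)).toReal := by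
          simpa only [hD] using hDnn
        linarith
      calc -(kineticEnergy u₀ * T⁻¹) = T⁻¹ * (-kineticEnergy u₀) := by ring
        _ ≤ T⁻¹ * ∫ t in (0 : ℝ)..T, P t := mul_le_mul_of_nonneg_left h2 hTi.le
  -- boundedness of the running means along `atTop`
  set E₀ : ℝ := kineticEnergy u₀ with hE₀
  set A : ℝ := (4 * Real.pi ^ 2 * ν)⁻¹ / 2 * ∫ x, ‖F x‖ ^ 2 with hA
  have hT1 : ∀ᶠ T : ℝ in atTop, 1 ≤ T := eventually_ge_atTop 1
  have hinv : ∀ T : ℝ, 1 ≤ T → E₀ * T⁻¹ ≤ E₀ := fun T hT =>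
    (mul_le_mul_of_nonneg_left (inv_le_one_of_one_le₀ hT) hE0).trans_eq (mul_one _)
  have hPge : ∀ᶠ T in atTop, -E₀ ≤ timeMean P T := by
    filter_upwards [hT1] with T hT
    exact le_trans (by linarith [hinv T hT]) (key T (by linarith)).2.2.2
  have hDge : ∀ᶠ T in atTop, 0 ≤ timeMean D T := by
    filter_upwards [hT1] with T hT using (key T (by linarith)).2.1
  have hDle : ∀ᶠ T in atTop, timeMean D T ≤ 2 * E₀ + 2 * A := by
    filter_upwards [hT1] with T hT
    have h := (key T (by linarith)).2.2.1
    have h' : 2 * E₀ * T⁻¹ ≤ 2 * E₀ := by nlinarith [hinv T hT]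
    linarith
  have hPle : ∀ᶠ T in atTop, timeMean P T ≤ R / 2 * T⁻¹ + timeMean D T := by
    filter_upwards [hT1] with T hT using (key T (by linarith)).1
  have hK : Tendsto (fun T : ℝ => R / 2 * T⁻¹) atTop (𝓝 0) := by
    simpa using tendsto_inv_atTop_zero.const_mul (R / 2)
  have hDbdd : IsBoundedUnder (· ≤ ·) atTop (timeMean D) := isBoundedUnder_of_eventually_le hDle
  -- pass to `lim sup`
  calc meanPower F u = limsup (timeMean P) atTop := rfl
    _ ≤ limsup ((fun T : ℝ => R / 2 * T⁻¹) + timeMean D) atTop :=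
        limsup_le_limsup (hPle.mono fun T hT => by simpa only [Pi.add_apply] using hT)
          (isCoboundedUnder_le_of_eventually_le atTop hPge)
          (isBoundedUnder_le_add hK.isBoundedUnder_le hDbdd)
    _ ≤ limsup (fun T : ℝ => R / 2 * T⁻¹) atTop + limsup (timeMean D) atTop :=
        limsup_add_le hK.isBoundedUnder_ge hK.isBoundedUnder_le
          (isCoboundedUnder_le_of_eventually_le atTop hDge) hDbdd
    _ = meanDissipation ν u := by
        rw [hK.limsup_eq, zero_add]
        rfl

omit [DecidableEq d] in
/-- A steady `L²` field lies in the guarded mixed class `L¹(0,T; L²(T^d))`. [folklore] -/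
theorem memLqLp_one_two_steady (hF : MemLp F 2 volume) (T : ℝ) :
    Torus.MemLqLp 1 2 (fun _ : ℝ => F) (Ioo 0 T) := by
  haveI : IsFiniteMeasure (volume.restrict (Ioo (0 : ℝ) T)) :=
    ⟨by rw [Measure.restrict_apply_univ]; exact measure_Ioo_lt_top⟩
  exact ⟨ae_of_all _ fun _ => hF, (memLp_const (eLpNorm F 2 volume).toReal).2⟩

end General

/-! ### On `𝕋³`: energy equality in the mean, Lions' class, and the door -/

variable {ν : ℝ} {F u₀ : UnitAddTorus (Fin 3) → EuclideanSpace ℝ (Fin 3)}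
  {u : ℝ → UnitAddTorus (Fin 3) → EuclideanSpace ℝ (Fin 3)}

/-- **Mean energy equality** `⟨F·u⟩ = ⟨ν‖∇u‖²⟩` for global Leray–Hopf solutions on `𝕋³`
satisfying the trajectory energy equality (steady mean-zero `F ∈ L²`, `ν > 0`): the upper half is
`lh_meanPower_le_meanDissipation_of_energyEq`, the lower half the Leray–Hopf power balance
inequality `DoeringFoias2002_dissipation_le_power_holds`.
[folklore; cite: DoeringFoias2002, §2; cite: CheskidovDoeringPetrov2006, eq. (11)] -/
theorem lh_meanPower_eq_meanDissipation_of_energyEq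
    (hu : Torus.IsGlobalLerayHopf ν (fun _ => F) u₀ u) (hν : 0 < ν) (hF : MemLp F 2 volume)
    (hF0 : HasZeroMean F)
    (hEq : ∀ T, 0 < T →
      kineticEnergy (u T) + ν * (∫⁻ τ in Ioo 0 T, eGradNormSq (u τ)).toReal =
        kineticEnergy u₀ + ∫ τ in (0 : ℝ)..T, ∫ x, ⟪F x, u τ x⟫_ℝ) :
    meanPower F u = meanDissipation ν u :=
  le_antisymm (lh_meanPower_le_meanDissipation_of_energyEq hu hν hF hF0 hEq)
    (DoeringFoias2002_dissipation_le_power_holds hν hF hF0 u₀ u hu)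

/-- **Lions' class gives the energy equality** (Lions 1960; Shinbrot 1974; the tree's
`lions_energy_equality_Ioc`): a global Leray–Hopf solution on `𝕋³` with `L²` datum, driven by a
steady continuous force, which lies in `L⁴(0,T; L⁴(𝕋³))` for every `T > 0`, satisfies
`½‖u(T)‖² + ν∫₀ᵀ‖∇u‖₂² = ½‖u₀‖² + ∫₀ᵀ∫⟪F,u⟫` for every `T > 0`.
[cite: Shinbrot1974, Thm. (p = r = 4)] -/
theorem lh_energyEq_of_memL4 (hu : Torus.IsGlobalLerayHopf ν (fun _ => F) u₀ u)
    (hFs : IsSmooth F) (hu₀ : MemLp u₀ 2 volume)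
    (hL4 : ∀ T, 0 < T → Torus.MemLqLp 4 4 u (Ioo 0 T)) {T : ℝ} (hT : 0 < T) :
    kineticEnergy (u T) + ν * (∫⁻ τ in Ioo 0 T, eGradNormSq (u τ)).toReal =
      kineticEnergy u₀ + ∫ τ in (0 : ℝ)..T, ∫ x, ⟪F x, u τ x⟫_ℝ :=
  lions_energy_equality_Ioc (by simp) (by simp) (hu T hT) hu₀ (hL4 T hT)
    (Literature.Analysis.FluidPDE.aestronglyMeasurable_stLift_steady hFs.continuous _)
    (memLqLp_one_two_steady (hFs.memLp 2) T) T ⟨hT, le_rfl⟩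

/-- **In Lions' class the mean energy equality holds**: `⟨F·u⟩ = ⟨ν‖∇u‖²⟩` for every global
Leray–Hopf solution on `𝕋³` of `NS_ν(F)` (`ν > 0`, `F` smooth with zero mean, `L²` datum) with
`u ∈ L⁴(0,T; L⁴)` for all `T`. [folklore; cite: Shinbrot1974, Thm.; cite: DoeringFoias2002, §2] -/
theorem lh_meanPower_eq_meanDissipation_of_memL4 (hu : Torus.IsGlobalLerayHopf ν (fun _ => F) u₀ u)
    (hν : 0 < ν) (hFs : IsSmooth F) (hF0 : HasZeroMean F) (hu₀ : MemLp u₀ 2 volume)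
    (hL4 : ∀ T, 0 < T → Torus.MemLqLp 4 4 u (Ioo 0 T)) :
    meanPower F u = meanDissipation ν u :=
  lh_meanPower_eq_meanDissipation_of_energyEq hu hν (hFs.memLp 2) hF0
    fun _ hT => lh_energyEq_of_memL4 hu hFs hu₀ hL4 hT

/-- **Floor ⟺ un-pinning, at Leray–Hopf level.** For a global Leray–Hopf solution of the
Kolmogorov-forced system (`ν > 0`) with mean energy equality `⟨f·u⟩ ≤ ⟨ν‖∇u‖²⟩` (the reverse
inequality is automatic), and every `ε`:
`ε ≤ meanDissipation ν u ↔ liminf_T ⟨∫ u₁u₃ sin(2πx₃)⟩_T ≤ 1/(4π) − 2πνε`.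
(`→` holds for every Leray–Hopf solution, `inphase_longTimeAvgInf_le_of_floor'`; `←` is the
exact identity `meanPower_kolForce_eq_inphase'` plus the mean energy equality.) [folklore] -/
theorem floor_iff_unpinned_of_meanEnergyEq
    (hu : Torus.IsGlobalLerayHopf ν (fun _ => kolForce) u₀ u) (hν : 0 < ν)
    (hEE : meanPower kolForce u ≤ meanDissipation ν u) (ε : ℝ) :
    ε ≤ meanDissipation ν u ↔
      longTimeAvgInf (fun t => ∫ x, u t x 2 * ⟪kolSin x, u t x⟫_ℝ) ≤
        (1 / 2 - 4 * Real.pi ^ 2 * ν * ε) / (2 * Real.pi) := by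
  refine ⟨inphase_longTimeAvgInf_le_of_floor' hu hν, fun hA => le_trans ?_ hEE⟩
  have hπ : 0 < 2 * Real.pi := by positivity
  have h4 : 0 < 4 * Real.pi ^ 2 * ν := by positivity
  rw [le_div_iff₀ hπ] at hA
  rw [meanPower_kolForce_eq_inphase' hu hν, le_div_iff₀ h4]
  linarith

/-- **Floor ⟺ un-pinning in Lions' class**: the same equivalence for a global Leray–Hopf solution
of `NS_ν(kolForce)` (`ν > 0`, `L²` datum) with `u ∈ L⁴(0,T; L⁴(𝕋³))` for every `T`.
[folklore; cite: Shinbrot1974, Thm.] -/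
theorem floor_iff_unpinned_of_memL4
    (hu : Torus.IsGlobalLerayHopf ν (fun _ => kolForce) u₀ u) (hν : 0 < ν)
    (hu₀ : MemLp u₀ 2 volume) (hL4 : ∀ T, 0 < T → Torus.MemLqLp 4 4 u (Ioo 0 T)) (ε : ℝ) :
    ε ≤ meanDissipation ν u ↔
      longTimeAvgInf (fun t => ∫ x, u t x 2 * ⟪kolSin x, u t x⟫_ℝ) ≤
        (1 / 2 - 4 * Real.pi ^ 2 * ν * ε) / (2 * Real.pi) :=
  floor_iff_unpinned_of_meanEnergyEq hu hν
    (lh_meanPower_eq_meanDissipation_of_memL4 hu hν isSmooth_kolForce hasZeroMean_kolForce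
      hu₀ hL4).le ε

/-- **The un-pinning door to `ZerothLaw`, Leray–Hopf level.** `ZerothLaw` follows from: positive
viscosities `ν_j → 0`, global Leray–Hopf solutions `u_j` of `NS_{ν_j}(kolForce)` from data `u₀_j`
with mean energies `≤ E`, MEAN ENERGY EQUALITY `⟨f·u_j⟩ ≤ ⟨ν_j‖∇u_j‖²⟩` for each `j`, and the
un-pinning of the in-phase flux `liminf_T ⟨∫ (u_j)₁(u_j)₃ sin(2πx₃)⟩_T ≤ 1/(4π) − 2πν_j ε` for one
`ε > 0` and all `j`. The witnesses are `kolForce, ν_j, u₀_j, u_j` themselves. No classical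
regularity is assumed (compare `zerothLaw_of_unpinned_classical_family`). [folklore] -/
theorem zerothLaw_of_unpinned_LH_family {νs : ℕ → ℝ}
    {u₀s : ℕ → UnitAddTorus (Fin 3) → EuclideanSpace ℝ (Fin 3)}
    {us : ℕ → ℝ → UnitAddTorus (Fin 3) → EuclideanSpace ℝ (Fin 3)}
    (hν : ∀ j, 0 < νs j) (hν0 : Tendsto νs atTop (𝓝 0))
    (hlh : ∀ j, Torus.IsGlobalLerayHopf (νs j) (fun _ => kolForce) (u₀s j) (us j))
    (hE : ∃ E : ℝ, ∀ j, meanEnergy (us j) ≤ E)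
    (hEE : ∀ j, meanPower kolForce (us j) ≤ meanDissipation (νs j) (us j))
    {ε : ℝ} (hε : 0 < ε)
    (hA : ∀ j, longTimeAvgInf (fun t => ∫ x, us j t x 2 * ⟪kolSin x, us j t x⟫_ℝ) ≤
      (1 / 2 - 4 * Real.pi ^ 2 * νs j * ε) / (2 * Real.pi)) :
    Literature.Turb.ZerothLaw :=
  ⟨kolForce, isSmooth_kolForce, isDivFree_kolForce, hasZeroMean_kolForce, νs, u₀s, us, hν, hν0,
    hlh, hE, ε, hε, fun j => (floor_iff_unpinned_of_meanEnergyEq (hlh j) (hν j) (hEE j) ε).2 (hA j)⟩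

/-- **The un-pinning door to `ZerothLaw`, Lions class.** `ZerothLaw` follows from: positive
viscosities `ν_j → 0`, global Leray–Hopf solutions `u_j` of `NS_{ν_j}(kolForce)` with `L²` data,
each in `L⁴(0,T; L⁴(𝕋³))` for every `T` (Lions–Shinbrot energy class — far short of regularity),
mean energies `≤ E`, and the un-pinning `liminf_T ⟨∫ (u_j)₁(u_j)₃ sin(2πx₃)⟩_T ≤ 1/(4π) − 2πν_j ε`
for one `ε > 0` and all `j`. By `floor_iff_unpinned_of_memL4` the un-pinning clause is, on this
class, EQUIVALENT to the dissipation floor, so this is an exact reformulation of `ZerothLaw`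
restricted to Kolmogorov-forced `L⁴ₜL⁴ₓ` Leray–Hopf witness families, with no gradient or
fine-scale quantity in it. [folklore; cite: Shinbrot1974, Thm.; cite: DoeringFoias2002, §2] -/
theorem zerothLaw_of_unpinned_L4_family {νs : ℕ → ℝ}
    {u₀s : ℕ → UnitAddTorus (Fin 3) → EuclideanSpace ℝ (Fin 3)}
    {us : ℕ → ℝ → UnitAddTorus (Fin 3) → EuclideanSpace ℝ (Fin 3)}
    (hν : ∀ j, 0 < νs j) (hν0 : Tendsto νs atTop (𝓝 0))
    (hlh : ∀ j, Torus.IsGlobalLerayHopf (νs j) (fun _ => kolForce) (u₀s j) (us j))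
    (hu₀ : ∀ j, MemLp (u₀s j) 2 volume)
    (hL4 : ∀ j T, 0 < T → Torus.MemLqLp 4 4 (us j) (Ioo 0 T))
    (hE : ∃ E : ℝ, ∀ j, meanEnergy (us j) ≤ E) {ε : ℝ} (hε : 0 < ε)
    (hA : ∀ j, longTimeAvgInf (fun t => ∫ x, us j t x 2 * ⟪kolSin x, us j t x⟫_ℝ) ≤
      (1 / 2 - 4 * Real.pi ^ 2 * νs j * ε) / (2 * Real.pi)) :
    Literature.Turb.ZerothLaw :=
  zerothLaw_of_unpinned_LH_family hν hν0 hlh hE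
    (fun j => (lh_meanPower_eq_meanDissipation_of_memL4 (hlh j) (hν j) isSmooth_kolForce
      hasZeroMean_kolForce (hu₀ j) (hL4 j)).le) hε hA

end Summit.AnomalousDissipation.AnomalousDissipation.Theorems

end
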